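import Literature.NumberTheory.Automorphic.FuchsianIncompleteEisensteinCusp

/-!
# Lemma 3.3 (unfolding) for bounded automorphic functions and integrable profiles
(Iwaniec, *Spectral Methods of Automorphic Forms*, GSM 53, Lemma 3.3 (3.14), PDF p. 44; §6.4
(the truncated Eisenstein series and the Maass–Selberg relations (6.29)–(6.30)), PDF p. 88)

Eleventh brick of the general-`Γ` Eisenstein series: the unfolding
`∫_F E_𝔞(z|ψ) f(z) dμ(z) = ∫₀^∞ ψ(y) f_𝔞(y) y⁻² dy` of `FuchsianIncompleteEisenstein(Cusp)`
(there for `ψ ∈ C_c`, `f` continuous) in the form the Maass–Selberg computation by unfolding needs: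
**`ψ` measurable with `∫₀^∞ |ψ(y)| y⁻² dy < ∞` and `f` automorphic, measurable and BOUNDED**
(`setIntegral_incEis_mul_of_bounded`, `setIntegral_incEisCusp_mul_of_bounded`), together with the
two profiles of the decomposition `E^Y_𝔞(s) = E_𝔞(·|y^s𝟙_{y≤Y}) - Σₖ φ_𝔞ₖ(s) E_𝔞ₖ(·|y^{1-s}𝟙_{y>Y})`
of the truncated Eisenstein series: `∫ |y^{1-s}𝟙_{y>Y}| y⁻² < ∞` for `Re s > 0`
(`integrableOn_highProfile`) and `∫ |y^s 𝟙_{y≤Y}| y⁻² < ∞` for `Re s > 1` (`integrableOn_lowProfile`).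
The only new analysis is the integrability of the strip integrand
(`integrableOn_stripIntegrand_of_bounded`: majorant `𝟙_{[0,1)}(x)·B|ψ(y)|y⁻²`, a product integrable on
`ℂ ≅ ℝ × ℝ`, `integrableOn_indicator_mul_upperHalf`); the coordinate formula
(`integral_strip_mul_eq_of_integrable`) and the unfolding are those of the earlier bricks
(`tsum_strip_smul_eq(_cusp)`, `setIntegral_tsum_smul_eq`). Everything is PROVED; nothing is
vendored; no fact is introduced.

## References
* [Iwaniec2002] H. Iwaniec, *Spectral Methods of Automorphic Forms*, 2nd ed., GSM 53, AMS 2002,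
  Lemma 3.3, PDF p. 44; §6.4, PDF p. 88 (held copy `book:iwaniec2002-spectral-methods-automorphic-forms`).

Mathlib: `Complex.volume_preserving_equiv_real_prod`, `MeasurePreserving.integrableOn_comp_preimage`,
`Integrable.mul_prod`, `integrableOn_Ioi_rpow_of_lt`, `intervalIntegral.intervalIntegrable_rpow'`,
`ContinuousOn.aemeasurable`. Literature: `stripIntegrand`, `stripIntegrand_eq`, `tsum_strip_smul_eq`,
`setIntegral_Ico_eq_cuspMean`, `incEis` (`FuchsianIncompleteEisenstein`); `incEisCusp`,
`tsum_strip_smul_eq_cusp`, `integrable_comp_sl_inv_smul`, `integral_comp_sl_inv_smul`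
(`FuchsianIncompleteEisensteinCusp`); `upperHalf_eq_preimage`, `setIntegral_upperHalf_eq_iterated`,
`integral_upperHalfPlane_eq_integral_complex`, `integrable_upperHalfPlane_iff_integrableOn_complex`
(`InvariantIntegralOperators`); `setIntegral_tsum_smul_eq` (`FundamentalDomainUnfolding`); `cuspMean`,
`cuspMeanAt` (`CuspidalSubspace`, `FuchsianCuspidalSubspace`); `cuspStrip` (`FuchsianCuspZones`).
-/

noncomputable section

namespace Literature.NumberTheory.Automorphic

open Matrix UpperHalfPlane
open scoped MatrixGroups

namespace Fuchsian

variable {Γ : Subgroup (GL (Fin 2) ℝ)}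

section Strip

open _root_.MeasureTheory _root_.Set _root_.Filter
open scoped _root_.Pointwise _root_.ENNReal _root_.Topology

/-- The majorant `𝟙_{[0,1)}(x) · g(y)` is integrable on the upper half-plane when `g` is integrable on
`(0, ∞)` (product structure of Lebesgue measure on `ℂ ≅ ℝ × ℝ`). [folklore] -/
theorem integrableOn_indicator_mul_upperHalf {g : ℝ → ℝ} (hg : IntegrableOn g (Ioi 0)) :
    IntegrableOn (fun z : ℂ => (Ico (0 : ℝ) 1).indicator (fun _ => (1 : ℝ)) z.re * g z.im)
      {z : ℂ | 0 < z.im} := by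
  have hmp := Complex.volume_preserving_equiv_real_prod
  have hme := Complex.measurableEquivRealProd.measurableEmbedding
  set G : ℝ × ℝ → ℝ := fun p => (Ico (0 : ℝ) 1).indicator (fun _ => (1 : ℝ)) p.1 * g p.2 with hG
  have hGi : IntegrableOn G (univ ×ˢ Ioi (0 : ℝ)) (volume.prod volume) := by
    rw [IntegrableOn, ← Measure.prod_restrict, Measure.restrict_univ]
    have h1 : Integrable (fun x : ℝ => (Ico (0 : ℝ) 1).indicator (fun _ => (1 : ℝ)) x) volume := by
      refine IntegrableOn.integrable_indicator ?_ measurableSet_Ico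
      exact integrableOn_const (by rw [Real.volume_Ico]; exact ENNReal.ofReal_ne_top)
    exact h1.mul_prod hg
  rw [upperHalf_eq_preimage, ← Measure.volume_eq_prod] at *
  have := (hmp.integrableOn_comp_preimage hme).mpr hGi
  exact this

/-- **Integrability of the strip integrand for a bounded `f` and a profile `ψ` with
`∫ |ψ(y)| y⁻² dy < ∞`** (no continuity, no compact support). [folklore] -/
theorem integrableOn_stripIntegrand_of_bounded {ψ : ℝ → ℂ} (hψm : Measurable ψ)
    (hψi : IntegrableOn (fun y : ℝ => ‖ψ y‖ * (y ^ 2)⁻¹) (Ioi 0))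
    {f : ℍ → ℂ} (hfm : Measurable f) {B : ℝ} (hfb : ∀ z, ‖f z‖ ≤ B) :
    IntegrableOn (stripIntegrand ψ f) {z : ℂ | 0 < z.im} := by
  set U : Set ℂ := {z : ℂ | 0 < z.im} with hU
  have hmeasU : MeasurableSet U := UpperHalfPlane.isOpen_upperHalfPlaneSet.measurableSet
  have hB0 : 0 ≤ B := (norm_nonneg _).trans (hfb UpperHalfPlane.I)
  -- measurability on `U`
  have hofc : AEMeasurable (UpperHalfPlane.ofComplex : ℂ → ℍ) (volume.restrict U) := by
    have hsrc : UpperHalfPlane.ofComplex.source = U := by simp [UpperHalfPlane.ofComplex, hU]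
    have hc : ContinuousOn (UpperHalfPlane.ofComplex : ℂ → ℍ) U := by
      rw [← hsrc]; exact UpperHalfPlane.ofComplex.continuousOn
    exact hc.aemeasurable hmeasU
  have hfae : AEStronglyMeasurable (fun z : ℂ => f (UpperHalfPlane.ofComplex z)) (volume.restrict U) :=
    (hfm.comp_aemeasurable hofc).aestronglyMeasurable
  have hae : AEStronglyMeasurable (stripIntegrand ψ f) (volume.restrict U) := by
    unfold stripIntegrand
    refine AEStronglyMeasurable.smul (𝕜 := ℝ) ?_ (AEStronglyMeasurable.mul ?_ (AEStronglyMeasurable.mul ?_ hfae))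
    · exact (Complex.continuous_im.measurable.pow_const 2).inv.aestronglyMeasurable
    · exact ((measurable_const.indicator measurableSet_Ico).comp Complex.measurable_re).aestronglyMeasurable
    · exact (hψm.comp Complex.measurable_im).aestronglyMeasurable
  -- the majorant
  have hmaj := integrableOn_indicator_mul_upperHalf (hψi.mul_const B)
  refine Integrable.mono' hmaj hae ?_
  filter_upwards [ae_restrict_mem hmeasU] with z hz
  unfold stripIntegrand
  rw [norm_smul, norm_mul, norm_mul, Real.norm_of_nonneg (by positivity)]
  have h2 : ‖(Ico (0 : ℝ) 1).indicator (fun _ => (1 : ℂ)) z.re‖ = (Ico (0 : ℝ) 1).indicator (fun _ => (1 : ℝ)) z.re := by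
    by_cases h : z.re ∈ Ico (0 : ℝ) 1
    · rw [indicator_of_mem h, indicator_of_mem h]; simp
    · rw [indicator_of_notMem h, indicator_of_notMem h]; simp
  rw [h2]
  have hi0 : 0 ≤ (Ico (0 : ℝ) 1).indicator (fun _ => (1 : ℝ)) z.re := indicator_nonneg (fun _ _ => zero_le_one) _
  have hy0 : 0 ≤ (z.im ^ 2)⁻¹ := by positivity
  calc (z.im ^ 2)⁻¹ * ((Ico (0 : ℝ) 1).indicator (fun _ => (1 : ℝ)) z.re * (‖ψ z.im‖ * ‖f (UpperHalfPlane.ofComplex z)‖))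
      ≤ (z.im ^ 2)⁻¹ * ((Ico (0 : ℝ) 1).indicator (fun _ => (1 : ℝ)) z.re * (‖ψ z.im‖ * B)) := by
        gcongr; exact hfb _
    _ = (Ico (0 : ℝ) 1).indicator (fun _ => (1 : ℝ)) z.re * (‖ψ z.im‖ * (z.im ^ 2)⁻¹ * B) := by ring

/-- The transported function `w ↦ 𝟙_P(w) ψ(Im w) f(w)` is integrable on `ℍ` under the same
hypotheses. [folklore] -/
theorem integrable_strip_mul_of_bounded {ψ : ℝ → ℂ} (hψm : Measurable ψ)
    (hψi : IntegrableOn (fun y : ℝ => ‖ψ y‖ * (y ^ 2)⁻¹) (Ioi 0))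
    {f : ℍ → ℂ} (hfm : Measurable f) {B : ℝ} (hfb : ∀ z, ‖f z‖ ≤ B) :
    Integrable fun w : ℍ => (cuspStrip 0).indicator (fun _ => (1 : ℂ)) w * (ψ w.im * f w) := by
  rw [integrable_upperHalfPlane_iff_integrableOn_complex]
  refine (integrableOn_stripIntegrand_of_bounded hψm hψi hfm hfb).congr_fun (fun z hz => ?_)
    UpperHalfPlane.isOpen_upperHalfPlaneSet.measurableSet
  exact stripIntegrand_eq ψ f hz

/-- **The strip integral in coordinates**, integrable version:
`∫_ℍ 𝟙_P ψ(Im) f dμ = ∫₀^∞ ψ(y) y⁻² f₀(y) dy` whenever the strip integrand is integrable. [cite: Iwaniec2002, Lemma 3.3 (3.14), PDF p. 44] -/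
theorem integral_strip_mul_eq_of_integrable {ψ : ℝ → ℂ} {f : ℍ → ℂ}
    (hint : IntegrableOn (stripIntegrand ψ f) {z : ℂ | 0 < z.im}) :
    ∫ w : ℍ, (cuspStrip 0).indicator (fun _ => (1 : ℂ)) w * (ψ w.im * f w) =
      ∫ y in Set.Ioi (0 : ℝ), (ψ y * (((y ^ 2)⁻¹ : ℝ) : ℂ)) * cuspMean f (UpperHalfPlane.ofComplex ⟨0, y⟩) := by
  rw [integral_upperHalfPlane_eq_integral_complex]
  have e1 : ∫ z in {z : ℂ | 0 < z.im}, ((z.im ^ 2)⁻¹ : ℝ) •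
      ((cuspStrip 0).indicator (fun _ => (1 : ℂ)) (UpperHalfPlane.ofComplex z) *
        (ψ (UpperHalfPlane.ofComplex z).im * f (UpperHalfPlane.ofComplex z))) =
      ∫ z in {z : ℂ | 0 < z.im}, stripIntegrand ψ f z :=
    setIntegral_congr_fun UpperHalfPlane.isOpen_upperHalfPlaneSet.measurableSet
      fun z hz => (stripIntegrand_eq ψ f hz).symm
  rw [e1, setIntegral_upperHalf_eq_iterated _ hint]
  refine setIntegral_congr_fun measurableSet_Ioi fun y hy => ?_
  have hy' : (0 : ℝ) < y := hy
  rw [← setIntegral_Ico_eq_cuspMean f hy']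
  unfold stripIntegrand
  simp only [Complex.real_smul]
  rw [← integral_const_mul, ← integral_indicator measurableSet_Ico]
  refine integral_congr_ae (Filter.Eventually.of_forall fun x => ?_)
  simp only [Set.indicator_apply, Set.mem_Ico]
  split_ifs
  · ring
  · simp

end Strip

/-! ## Lemma 3.3 for bounded automorphic `f` and integrable profiles -/

section Unfolding

open _root_.MeasureTheory _root_.Set _root_.Filter
open scoped _root_.Pointwise _root_.ENNReal _root_.Topology

/-- **Lemma 3.3, bounded version, at `∞`**: `Γ ≤ SL₂(ℝ)` discrete, `-1 ∈ Γ`, periods `ℤ`, `F` a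
fundamental domain; `ψ` measurable with `∫₀^∞ |ψ(y)| y⁻² dy < ∞`; `f` automorphic, measurable and
bounded. Then `∫_F E(z|ψ) f(z) dμ(z) = ∫₀^∞ ψ(y) f₀(y) y⁻² dy`. (The printed Lemma 3.3 takes
`ψ ∈ C_c^∞(ℝ⁺)`; the unfolding needs only absolute convergence, which is what this version records —
e.g. for the cut powers `y^s 𝟙_{y ≤ Y}`, `Re s > 1`, and `y^{1-s} 𝟙_{y > Y}` of the truncated
Eisenstein series.) [cite: Iwaniec2002, Lemma 3.3 (3.14) & §6.4, PDF pp. 44, 88] -/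
theorem setIntegral_incEis_mul_of_bounded
    (hΓ : Γ ≤ (Matrix.SpecialLinearGroup.toGL : SL(2, ℝ) →* GL (Fin 2) ℝ).range)
    (hneg : (-1 : GL (Fin 2) ℝ) ∈ Γ) (hd : IsDiscreteSubgroup Γ)
    (hP : Γ.strictPeriods = AddSubgroup.zmultiples 1) {F : Set ℍ} (hF : IsHypFundamentalDomain Γ F)
    {ψ : ℝ → ℂ} (hψm : Measurable ψ) (hψi : IntegrableOn (fun y : ℝ => ‖ψ y‖ * (y ^ 2)⁻¹) (Ioi 0))
    {f : ℍ → ℂ} (hfa : IsAutomorphic Γ f) (hfm : Measurable f) {B : ℝ} (hfb : ∀ z, ‖f z‖ ≤ B) :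
    ∫ z in F, incEis Γ ψ z * f z =
      ∫ y in Set.Ioi (0 : ℝ), (ψ y * (((y ^ 2)⁻¹ : ℝ) : ℂ)) * cuspMean f (UpperHalfPlane.ofComplex ⟨0, y⟩) := by
  set Φ : ℍ → ℂ := fun w => (cuspStrip 0).indicator (fun _ => (1 : ℂ)) w * (ψ w.im * f w) with hΦ
  have hΦi : Integrable Φ := integrable_strip_mul_of_bounded hψm hψi hfm hfb
  have hunf := setIntegral_tsum_smul_eq hΓ hneg hd.countable hF hΦi
  have hpt : ∀ z : ℍ, incEis Γ ψ z * f z = (1 / 2) * ∑' γ : Γ, Φ ((γ : GL (Fin 2) ℝ) • z) := by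
    intro z
    simp only [hΦ]
    rw [tsum_strip_smul_eq hΓ hd hP ψ hfa z]
    ring
  simp_rw [hpt]
  rw [integral_const_mul, hunf,
    ← integral_strip_mul_eq_of_integrable (integrableOn_stripIntegrand_of_bounded hψm hψi hfm hfb)]
  ring

/-- **Lemma 3.3, bounded version, at an arbitrary cusp `𝔞 = σ∞`**:
`∫_F E_𝔞(z|ψ) f(z) dμ(z) = ∫₀^∞ ψ(y) f_𝔞(y) y⁻² dy` with `f_𝔞 = cuspMeanAt σ f`, for `ψ` measurable
with `∫ |ψ| y⁻² < ∞` and `f` automorphic, measurable and bounded. [cite: Iwaniec2002, Lemma 3.3 (3.14) & §6.4, PDF pp. 44, 88] -/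
theorem setIntegral_incEisCusp_mul_of_bounded
    (hΓ : Γ ≤ (Matrix.SpecialLinearGroup.toGL : SL(2, ℝ) →* GL (Fin 2) ℝ).range)
    (hneg : (-1 : GL (Fin 2) ℝ) ∈ Γ) (hd : IsDiscreteSubgroup Γ) {F : Set ℍ}
    (hF : IsHypFundamentalDomain Γ F) (σ : SL(2, ℝ))
    (hper : (ConjAct.toConjAct (Matrix.SpecialLinearGroup.toGL σ : GL (Fin 2) ℝ)⁻¹ • Γ).strictPeriods =
      AddSubgroup.zmultiples 1)
    {ψ : ℝ → ℂ} (hψm : Measurable ψ) (hψi : IntegrableOn (fun y : ℝ => ‖ψ y‖ * (y ^ 2)⁻¹) (Ioi 0))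
    {f : ℍ → ℂ} (hfa : IsAutomorphic Γ f) (hfm : Measurable f) {B : ℝ} (hfb : ∀ z, ‖f z‖ ≤ B) :
    ∫ z in F, incEisCusp Γ σ ψ z * f z =
      ∫ y in Set.Ioi (0 : ℝ), (ψ y * (((y ^ 2)⁻¹ : ℝ) : ℂ)) *
        cuspMeanAt σ f (UpperHalfPlane.ofComplex ⟨0, y⟩) := by
  set f' : ℍ → ℂ := fun v => f (σ • v) with hf'
  have hf'm : Measurable f' := hfm.comp (continuous_const_smul σ).measurable
  have hf'b : ∀ z, ‖f' z‖ ≤ B := fun z => hfb _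
  set Φ₀ : ℍ → ℂ := fun w => (cuspStrip 0).indicator (fun _ => (1 : ℂ)) w * (ψ w.im * f' w) with hΦ₀
  have hΦ₀i : Integrable Φ₀ := integrable_strip_mul_of_bounded hψm hψi hf'm hf'b
  set Φ : ℍ → ℂ := fun v => Φ₀ (σ⁻¹ • v) with hΦ
  have hΦi : Integrable Φ := integrable_comp_sl_inv_smul hΦ₀i σ
  have hunf := setIntegral_tsum_smul_eq hΓ hneg hd.countable hF hΦi
  have hpt : ∀ z : ℍ, incEisCusp Γ σ ψ z * f z = (1 / 2) * ∑' γ : Γ, Φ ((γ : GL (Fin 2) ℝ) • z) := by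
    intro z
    have h := tsum_strip_smul_eq_cusp hΓ hd σ hper ψ hfa z
    have e : (fun γ : Γ => Φ ((γ : GL (Fin 2) ℝ) • z)) = fun γ : Γ =>
        (cuspStrip 0).indicator (fun _ => (1 : ℂ)) (σ⁻¹ • (γ : GL (Fin 2) ℝ) • z) *
          (ψ (σ⁻¹ • (γ : GL (Fin 2) ℝ) • z).im * f ((γ : GL (Fin 2) ℝ) • z)) := by
      funext γ
      simp only [hΦ, hΦ₀, hf', smul_inv_smul]
    rw [e, h]; ring
  simp_rw [hpt]
  rw [integral_const_mul, hunf, hΦ, integral_comp_sl_inv_smul Φ₀ σ, hΦ₀,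
    integral_strip_mul_eq_of_integrable (integrableOn_stripIntegrand_of_bounded hψm hψi hf'm hf'b)]
  rw [show (1 / 2 : ℂ) * (2 * _) = _ from by ring]
  rfl

/-! ### The two profiles of the truncated Eisenstein series -/

/-- `∫ |y^{1-s} 𝟙_{y>Y}| y⁻² dy < ∞` for `Re s > 0`, `Y > 0`. [folklore] -/
theorem integrableOn_highProfile {s : ℂ} (hs : 0 < s.re) {Y : ℝ} (hY : 0 < Y) :
    IntegrableOn (fun y : ℝ => ‖(if Y < y then ((y : ℝ) : ℂ) ^ (1 - s) else 0)‖ * (y ^ 2)⁻¹) (Ioi 0) := by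
  have h1 : IntegrableOn (fun y : ℝ => y ^ (-s.re - 1)) (Ioi Y) :=
    integrableOn_Ioi_rpow_of_lt (by linarith) hY
  have h2 : IntegrableOn (fun y : ℝ => y ^ (-s.re - 1)) (Ioi 0 ∩ Ioi Y) := h1.mono_set inter_subset_right
  have hE : IntegrableOn (fun y : ℝ => ‖(if Y < y then ((y : ℝ) : ℂ) ^ (1 - s) else 0)‖ * (y ^ 2)⁻¹) (Ioi 0 ∩ Ioi Y) := by
    refine h2.congr_fun (fun y hy => ?_) (measurableSet_Ioi.inter measurableSet_Ioi)
    have hy0 : 0 < y := hy.1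
    have hYy : Y < y := hy.2
    show y ^ (-s.re - 1) = ‖(if Y < y then ((y : ℝ) : ℂ) ^ (1 - s) else 0)‖ * (y ^ 2)⁻¹
    rw [if_pos hYy, Complex.norm_cpow_eq_rpow_re_of_pos hy0]
    simp only [Complex.sub_re, Complex.one_re]
    rw [show (-s.re - 1 : ℝ) = (1 - s.re) + (-2) by ring, Real.rpow_add hy0, Real.rpow_neg hy0.le,
      Real.rpow_two]
  have hZ : IntegrableOn (fun y : ℝ => ‖(if Y < y then ((y : ℝ) : ℂ) ^ (1 - s) else 0)‖ * (y ^ 2)⁻¹) (Ioi 0 \ Ioi Y) := by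
    refine integrableOn_zero.congr_fun (fun y hy => ?_) (measurableSet_Ioi.diff measurableSet_Ioi)
    have : ¬ Y < y := hy.2
    rw [if_neg this]; simp
  have := hE.union hZ
  rwa [inter_union_sdiff] at this

/-- `∫ |y^{s} 𝟙_{y ≤ Y}| y⁻² dy < ∞` over `(0, ∞)` for `Re s > 1`. [folklore] -/
theorem integrableOn_lowProfile {s : ℂ} (hs : 1 < s.re) {Y : ℝ} (hY : 0 < Y) :
    IntegrableOn (fun y : ℝ => ‖(if y ≤ Y then ((y : ℝ) : ℂ) ^ s else 0)‖ * (y ^ 2)⁻¹) (Ioi 0) := by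
  have h1 : IntegrableOn (fun y : ℝ => y ^ (s.re - 2)) (Ioc 0 Y) := by
    have := intervalIntegral.intervalIntegrable_rpow' (a := 0) (b := Y) (r := s.re - 2) (by linarith)
    rw [intervalIntegrable_iff_integrableOn_Ioc_of_le hY.le] at this
    exact this
  have hE : IntegrableOn (fun y : ℝ => ‖(if y ≤ Y then ((y : ℝ) : ℂ) ^ s else 0)‖ * (y ^ 2)⁻¹) (Ioc 0 Y) := by
    refine h1.congr_fun (fun y hy => ?_) measurableSet_Ioc
    have hy0 : 0 < y := hy.1
    show y ^ (s.re - 2) = ‖(if y ≤ Y then ((y : ℝ) : ℂ) ^ s else 0)‖ * (y ^ 2)⁻¹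
    rw [if_pos hy.2, Complex.norm_cpow_eq_rpow_re_of_pos hy0,
      show (s.re - 2 : ℝ) = s.re + (-2) by ring, Real.rpow_add hy0, Real.rpow_neg hy0.le, Real.rpow_two]
  have hZ : IntegrableOn (fun y : ℝ => ‖(if y ≤ Y then ((y : ℝ) : ℂ) ^ s else 0)‖ * (y ^ 2)⁻¹) (Ioi Y) := by
    refine integrableOn_zero.congr_fun (fun y hy => ?_) measurableSet_Ioi
    have : ¬ y ≤ Y := not_le.mpr hy
    rw [if_neg this]; simp
  have := hE.union hZ
  rwa [Ioc_union_Ioi_eq_Ioi hY.le] at this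

end Unfolding

end Fuchsian

end Literature.NumberTheory.Automorphic

end
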